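import Summits.PneNP.PneNP.Theorems.SymmetryBudgetNoHiddenOrderBranchSumNoRegrowth

/-!
# BranchSum VII: decoupling of waiting cells (CG84-FLATNESS.md §10.2 (iii), §11.4 (i), §12.3)

A cell `Y` that WAITS — is the same set at every node of an interval `[k, k']` of a refinement path
(`BranchSum.RefinementPath`, H1–H5 of CG84-FLATNESS §9.3) — learns nothing about the material
processed meanwhile:

* `homogeneous_of_removed_of_cell_eq` : a vertex removed during the wait is complete or empty to `Y`
  (hypothesis H4 `removal`, read at the node `k'` where `Y` is still a cell);
* `block_homogeneous_of_cell_eq` (**LEMMA D**): if moreover a whole node-`k` cell `Z` has been removed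
  by node `k'`, then the block `Z × Y` is complete or empty — every vertex of `Z` is individually
  homogeneous to `Y`, and by equitability at node `k` all vertices of `Z` have the same number of
  neighbours in `Y`;
* `enteredCell_block_homogeneous` (**sibling decoupling**): with entered-vertex data `x` as in
  `SymmetryBudgetNoHiddenOrderBranchSumNoRegrowth.lean` (`x k ∈ W k ∖ W (k+1)`, entered cell of
  exactly `d k` elements), if `d k ≤ d k'` then the cell entered at node `k` is block-homogeneous to
  every cell that waits over `[k, k']`: by no-re-growth (F3, `disjoint_enteredCell_W`) the entered cell
  is gone by node `k'`.  In the Corneil–Goldberg process this says that inside a block processed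
  depth-first every cross block between a processed piece and a waiting sibling is complete or empty
  (the block is cograph-like), so all connectivity holding the waiting sibling is external glue
  (memo §11.4 (i), §12.3 G4).
-/

namespace Summit.PneNP.PneNP.Theorems

open Finset

namespace BranchSum

variable {V : Type*} [DecidableEq V] {G : SimpleGraph V} [DecidableRel G.Adj] {N : ℕ}

namespace RefinementPath

variable (R : RefinementPath G N)

/-- A vertex present at node `j` and removed by node `k' > j` is complete or empty to every cell of
node `k'`; stated for a cell `Y = cell k w` that is still a cell at node `k'`. -/
theorem homogeneous_of_removed_of_cell_eq {j k k' : ℕ} (hjk : j < k') {w : V} (hw : w ∈ R.W k')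
    (hcell : R.cell k' w = R.cell k w) {v : V} (hv : v ∈ R.W j) (hv' : v ∉ R.W k') :
    (∀ y ∈ R.cell k w, G.Adj v y) ∨ ∀ y ∈ R.cell k w, ¬ G.Adj v y := by
  rw [← hcell]
  exact R.removal j k' hjk v hv hv' w hw

/-- **LEMMA D (decoupling).** Let `Y = cell k w` still be a cell at node `k' > k`, and let the whole
node-`k` cell of `z` be removed by node `k'`.  Then the block between that cell and `Y` is complete or
empty. -/
theorem block_homogeneous_of_cell_eq {k k' : ℕ} (hkk' : k < k') {w : V} (hw : w ∈ R.W k')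
    (hcell : R.cell k' w = R.cell k w) {z : V} (hz : z ∈ R.W k)
    (hgone : ∀ v ∈ R.cell k z, v ∉ R.W k') :
    (∀ v ∈ R.cell k z, ∀ y ∈ R.cell k w, G.Adj v y) ∨ ∀ v ∈ R.cell k z, ∀ y ∈ R.cell k w, ¬ G.Adj v y := by
  have hwk : w ∈ R.W k := R.W_subset_of_le (le_of_lt hkk') hw
  -- `z` itself is homogeneous to `Y`
  have hz' := R.homogeneous_of_removed_of_cell_eq hkk' hw hcell hz (hgone z (R.self_mem_cell hz))
  -- every `v` in the cell of `z` has as many neighbours in `Y` as `z` has (equitability at node `k`)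
  have hcnt : ∀ v ∈ R.cell k z, ((R.cell k w).filter fun y => G.Adj v y).card =
      ((R.cell k w).filter fun y => G.Adj z y).card := fun v hv =>
    R.equitable k v (R.cell_subset_W k z hv) z hz (R.mem_cell_iff.1 hv).2 w hwk
  rcases hz' with hall | hnone
  · refine Or.inl fun v hv => ?_
    have h : ((R.cell k w).filter fun y => G.Adj v y).card = (R.cell k w).card := by
      rw [hcnt v hv, Finset.card_filter_eq_iff]; exact hall
    exact Finset.card_filter_eq_iff.1 h
  · refine Or.inr fun v hv => ?_
    have h : ((R.cell k w).filter fun y => G.Adj v y).card = 0 := by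
      rw [hcnt v hv, Finset.card_filter_eq_zero_iff]; exact hnone
    exact Finset.card_filter_eq_zero_iff.1 h

/-- **Sibling decoupling.** With entered-vertex data `x` (the vertex `x k ∈ W k ∖ W (k+1)` whose
node-`k` cell — the entered cell — has exactly `d k` elements): if `k < k'`, `d k ≤ d k'`, and
`Y = cell k w` is still a cell at node `k'`, then the cell entered at node `k` is block-homogeneous to
`Y`.  (F3: the entered cell is disjoint from `W k'`; then LEMMA D.) -/
theorem enteredCell_block_homogeneous (x : ℕ → V)
    (hx : ∀ k < N, x k ∈ R.W k ∧ x k ∉ R.W (k + 1) ∧ (R.cell k (x k)).card = R.d k)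
    {k k' : ℕ} (hkk' : k < k') (hd : R.d k ≤ R.d k') {w : V} (hw : w ∈ R.W k')
    (hcell : R.cell k' w = R.cell k w) :
    (∀ v ∈ R.cell k (x k), ∀ y ∈ R.cell k w, G.Adj v y) ∨
      ∀ v ∈ R.cell k (x k), ∀ y ∈ R.cell k w, ¬ G.Adj v y := by
  have hk : k < N := lt_trans hkk' (R.lt_N_of_mem hw)
  have hdisj := R.disjoint_enteredCell_W x hx hkk' hd
  exact R.block_homogeneous_of_cell_eq hkk' hw hcell (hx k hk).1
    (fun v hv hv' => disjoint_left.1 hdisj hv hv')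

end RefinementPath

end BranchSum

end Summit.PneNP.PneNP.Theorems
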